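import Literature.NumberTheory.EllipticCurves.NewformGaloisRepModLAssemblyPadicAlgClProofs
import Literature.NumberTheory.EllipticCurves.NewformGaloisRepModLOfTheoremA
import Literature.NumberTheory.Automorphic.GLnAdelicStructureProofs
import Literature.NumberTheory.Automorphic.BaseChangeStrongCuspidalPrime
import HarnessLib

/-!
# Deligne–Serre 1974, Thm. 6.1 at every finite place from Harris–Lan–Taylor–Thorne's Thm. A
# alone (proofs only)

A *proofs* file (theorems only: no definition, no named fact; D-0026) for the named fact
`Literature.NumberTheory.EllipticCurves.ModularForms.DeligneSerre1974.thm61_exists_adicGaloisRep`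
(`NewformGaloisRepModLAssembly`) — Deligne–Serre, *Formes modulaires de poids 1*, Ann. Sci. ÉNS (4)
7 (1974), Thm. 6.1, p. 520: for a non-zero `T_p`-eigenform `g ∈ S_k(Γ₁(M), χ)` (`p ∤ M`), `k ≥ 2`,
a number field `e : K → ℂ` containing the `a_p` and the `χ(p)`, and EVERY finite place `v` of `K`,
a continuous semisimple `ρ : Gal(ℚ̄/ℚ) → GL₂(K_v)`, unramified at `p ∤ M`, `p ∉ v`, with
`det(X - ρ(Frob_p)) = X² - a_p X + χ(p) p^{k-1}` (Deligne's theorem [Deligne1971Bourbaki355];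
Rem. 6.2 of the paper).

The companion file `NewformGaloisRepModLAssemblyPadicAlgClProofs` reduced the named fact to
Deligne's theorem in `ℚ̄_ℓ`-form and thence (`thm61_exists_adicGaloisRep_of_theoremA_of_dictionary`,
`thm61_exists_adicGaloisRep_of_langS27_of_dictionary`) to three inputs: Harris–Lan–Taylor–Thorne's
Thm. A in its existence half (the named fact `HarrisLanTaylorThorne2016.theoremA_existence` of
`ReciprocityGLnProofs`; or the stronger lang.S27, `exists_galoisRep_of_regularAlgebraic`), the
compactness `hcpt` of `GL₂(𝒪̂_ℚ)` and the adelic dictionary `hdict` (eigenform `g ↦` regular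
algebraic cuspidal `π` of `GL₂(𝔸_ℚ)` with Satake parameter `{(√p β₁)⁻¹, (√p β₂)⁻¹}` at `p ∤ M`,
`βⱼ` the roots of `X² - a_p X + χ(p) p^{k-1}`).  The last two are now THEOREMS of the tree —
`isCompact_glFiniteIntegralLevel_holds` (`GLnAdelicStructureProofs`) and `hdict_holds`
(`NewformGaloisRepModLOfTheoremA`: Gelbart's dictionary `g ↦ π_g ⊗ (ψ_{χ⁻¹} |·|^{k/2} ∘ det)`,
assembled from the `NewformAdelisation*` / `NewformAutomorphicRep*` files) — so this file records
the net statement: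

* `thm61_exists_adicGaloisRep_of_theoremA` — **Thm. 6.1 at every finite place (the named fact)
  follows from `HarrisLanTaylorThorne2016.theoremA_existence` and nothing else**;
* `thm61_exists_adicGaloisRep_of_langS27` — the same from lang.S27
  (`exists_galoisRep_of_regularAlgebraic`, via the proved `theoremA_existence_of`);
* `deligne_padicAlgCl_of_theoremA_rankTwoRat_of_dictionary`,
  `thm61_exists_adicGaloisRep_of_theoremA_rankTwoRat` — only the instance `n = 2`, `K = ℚ` of
  Thm. A is used (over `ℚ` Varma's compatibility at the unramified places is automatic,
  `Varma2024.corollary93_unramified_rat`), so the named fact follows from **that instance alone**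
  — which, at the `π` attached to holomorphic eigenforms of weight `≥ 2`, is Deligne's theorem
  itself (Rem. 6.2 of the paper);
* `thm61_exists_adicGaloisRep_of_leaves`, `thm61_exists_adicGaloisRep_of_namedLeaves` — the
  residue in the tree's deepest automorphic leaves: the tree proves the printed proof of Thm. A
  (existence, `n ≥ 2`: Cor. 7.14 from Thm. 7.13 by Sorensen patching over the family `K(√-D)`,
  `theoremA_existence_of_baseChange` of `ReciprocityGLnExistenceProofs`; all `n`:
  `theoremA_existence_of_namedLeaves` of `BaseChangeStrongCuspidalPrime`) modulo exactly three
  named facts — Harris–Lan–Taylor–Thorne's Cor. 6.27 (`corollary627_splitOrUnramified`),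
  Arthur–Clozel's strong cuspidal base change in prime degree
  (`ArthurClozel1989_strongLifting_cuspidal`, or its raw eight-line form `hBC`) and its
  archimedean clause (`ArthurClozel1989_strongLifting_archimedean`) — hence so does Thm. 6.1 at
  every finite place; for `n = 2` over `ℚ` the rank-one case (Weil) is not needed.

Consequently every statement the tree has already reduced to `thm61_exists_adicGaloisRep`
(`Ribet1977.thm21_exists_galoisRep` by `Ribet1977.thm21_exists_galoisRep_of_thm61` of
`NewformGaloisRepDeligneOfThm61Proofs`, `thm67_weightOne` by `thm67_weightOne_holds_of` of
`NewformGaloisRepModLAssembly`, `Hida2000_thm326_exists_galoisRep` by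
`Hida2000_thm326_exists_galoisRep_of_thm61` of `NewformGaloisRepPadicAlgClProofs`, `thm41_exists` by
`thm41_exists_of_thm61` of `DeligneSerreWeightOneOfThm61`, …) is a consequence of Thm. A alone.  In the other direction Thm. A for `n = 2` over `ℚ` at the `π` coming from
holomorphic eigenforms of weight `≥ 2` *is* Deligne's theorem (Deligne–Serre, Rem. 6.2; Carayol,
Taylor for the Hilbert case), so no smaller named fact of the tree can stand in for it: a discharge
`thm61_exists_adicGaloisRep_holds` is `thm61_exists_adicGaloisRep_of_theoremA h` for a proof `h` of
`HarrisLanTaylorThorne2016.theoremA_existence`, once one exists, or Deligne's own construction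
(parabolic `ℓ`-adic cohomology of modular curves, the Eichler–Shimura congruence relation), which
the tree does not have.

## References

* P. Deligne, J.-P. Serre, *Formes modulaires de poids 1*, Ann. Sci. ÉNS (4) 7 (1974), 507–530:
  Thm. 6.1 (p. 520), Rem. 6.2 and footnote (2) (p. 521). [DeligneSerreASENS1974]
* P. Deligne, *Formes modulaires et représentations `ℓ`-adiques*, Sém. Bourbaki 355, LNM 179
  (1971), 139–172. [Deligne1971Bourbaki355]
* M. Harris, K.-W. Lan, R. Taylor, J. Thorne, *On the rigid cohomology of certain Shimura
  varieties*, Res. Math. Sci. 3 (2016), Thm. A (p. 3). [HarrisLanTaylorThorneRMS2016]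
* S. Gelbart, *Automorphic forms on adele groups*, Ann. of Math. Stud. 83 (1975), §3, Prop. 3.1,
  Lemma 3.7. [Gelbart1975]
-/

noncomputable section

open scoped MatrixGroups ModularForm NumberField Polynomial
open CongruenceSubgroup IsDedekindDomain Polynomial Rat.HeightOneSpectrum

namespace Literature.NumberTheory.EllipticCurves.ModularForms.DeligneSerre1974

open Literature.NumberTheory.Automorphic Literature.NumberTheory.GaloisRepresentations

/-- **Deligne–Serre 1974, Thm. 6.1 at every finite place, from Harris–Lan–Taylor–Thorne's Thm. A
(existence) alone.**  For every non-zero `T_p`-eigenform `g ∈ S_k(Γ₁(M), χ)` (`p ∤ M`), `k ≥ 2`,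
every number field `e : K → ℂ` carrying the eigenvalues and the values of `χ`, and every finite
place `v` of `K`, there is a continuous semisimple `ρ : Gal(ℚ̄/ℚ) → GL₂(K_v)` unramified at `p ∤ M`,
`p ∉ v`, with `det(X - ρ(Frob_p)) = X² - a_p X + χ(p) p^{k-1}` — granted the named fact
`HarrisLanTaylorThorne2016.theoremA_existence`: the compactness of `GL₂(𝒪̂_ℚ)` is
`isCompact_glFiniteIntegralLevel_holds` and the adelic dictionary is `hdict_holds`, fed to
`thm61_exists_adicGaloisRep_of_theoremA_of_dictionary` (Deligne's theorem in `ℚ̄_ℓ`-form from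
Thm. A, then the odd descent of footnote (2), p. 521, to `K_v`).
[cite: DeligneSerreASENS1974, Thm. 6.1 (p. 520) and footnote (2) (p. 521)]
[cite: HarrisLanTaylorThorneRMS2016, Thm. A (p. 3)] -/
theorem thm61_exists_adicGaloisRep_of_theoremA (hA : HarrisLanTaylorThorne2016.theoremA_existence) :
    thm61_exists_adicGaloisRep :=
  thm61_exists_adicGaloisRep_of_theoremA_of_dictionary hA (isCompact_glFiniteIntegralLevel_holds 2 ℚ)
    (hdict_holds (isCompact_glFiniteIntegralLevel_holds 2 ℚ))

/-- **Deligne–Serre 1974, Thm. 6.1 at every finite place, from lang.S27 alone**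
(`exists_galoisRep_of_regularAlgebraic`: Harris–Lan–Taylor–Thorne's Thm. A with Varma's
compatibility at every `v ∤ ℓ`), through the proved `HarrisLanTaylorThorne2016.theoremA_existence_of`.
[cite: DeligneSerreASENS1974, Thm. 6.1 (p. 520)] [cite: HarrisLanTaylorThorneRMS2016, Thm. A (p. 3)] -/
theorem thm61_exists_adicGaloisRep_of_langS27 (h27 : exists_galoisRep_of_regularAlgebraic) :
    thm61_exists_adicGaloisRep :=
  thm61_exists_adicGaloisRep_of_theoremA (HarrisLanTaylorThorne2016.theoremA_existence_of h27)

/-! ### Only the rank-two rational instance of Thm. A is used -/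

section RankTwoRat

/-- **Deligne's theorem in `ℚ̄_ℓ`-form from the instance `n = 2`, `K = ℚ` of Harris–Lan–Taylor–
Thorne's Thm. A (existence) and the adelic dictionary.**  As
`deligne_padicAlgCl_of_theoremA_of_dictionary` (`NewformGaloisRepOfRegularAlgebraicProofs`), but
the hypothesis is only the rank-two rational instance `hA₂` of `theoremA_existence`: for every
regular algebraic cuspidal `π` on `GL₂(𝔸_ℚ)`, every `ℓ` and `ι : ℚ̄_ℓ ≃+* ℂ`, a continuous
semisimple `r : Γ_ℚ → GL₂(ℚ̄_ℓ)` with Harris–Lan–Taylor–Thorne's property `IsCompatible π ι r`.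
Over `ℚ` that property already gives the Frobenius polynomial at EVERY unramified `p ≠ ℓ`
(`Varma2024.corollary93_unramified_rat`: a rational prime has one place above it), and at the `π`
of the dictionary (`hdict`: Satake parameter `{(√p β₁)⁻¹, (√p β₂)⁻¹}` at `p ∤ M`) the polynomial
`arithFrobPolyOfSatake ι p 2 {(√p βⱼ)⁻¹}` is `X² - ι⁻¹(a_p) X + ι⁻¹(χ(p) p^{k-1})`
(`arithFrobPolyOfSatake_heckeRoots`).
[cite: DeligneSerreASENS1974, Thm. 6.1 (p. 520) and Rem. 6.2 (p. 521)]
[cite: HarrisLanTaylorThorneRMS2016, Thm. A (p. 3)] -/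
theorem deligne_padicAlgCl_of_theoremA_rankTwoRat_of_dictionary
    (hA₂ : ∀ (hcpt : isCompact_glFiniteIntegralLevel 2 ℚ) (π : CuspidalAutomorphicRepData 2 ℚ hcpt),
      π.1.IsRegularAlgebraic → ∀ (ℓ : ℕ) [Fact ℓ.Prime] (ι : PadicAlgCl ℓ ≃+* ℂ),
        ∃ r : FramedGaloisRep ℚ (PadicAlgCl ℓ) 2,
          r.toGaloisRep.IsSemisimple ∧ HarrisLanTaylorThorne2016.IsCompatible π.1 ι r)
    (hcpt : isCompact_glFiniteIntegralLevel 2 ℚ)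
    (hdict : ∀ (M : ℕ) [NeZero M] (k : ℤ), 2 ≤ k →
      ∀ (g : CuspForm (Gamma1 M) k) (χ : DirichletCharacter ℂ M),
        g ∈ nebentypusSubspace M k χ → g ≠ 0 →
      ∀ (a : ℕ → ℂ),
        (∀ (p : ℕ) (hp : p.Prime), ¬ p ∣ M →
          (haveI : NeZero p := ⟨hp.ne_zero⟩; heckeT (Gamma1 M) k p g) = a p • g) →
      ∃ π : CuspidalAutomorphicRepData 2 ℚ hcpt, π.1.IsRegularAlgebraic ∧
        ∀ w : HeightOneSpectrum (𝓞 ℚ), ¬ ((primesEquiv w : Nat.Primes) : ℕ) ∣ M →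
          π.1.HasSatakeParamAt w
            ((X ^ 2 - C (a ((primesEquiv w : Nat.Primes) : ℕ)) * X +
                C (χ ((primesEquiv w : Nat.Primes) : ℕ) *
                  (((primesEquiv w : Nat.Primes) : ℕ) : ℂ) ^ (k - 1)) : ℂ[X]).roots.map
              fun β ↦ (((Real.sqrt ((primesEquiv w : Nat.Primes) : ℕ) : ℝ) : ℂ) * β)⁻¹))
    (M : ℕ) [NeZero M] (k : ℤ) (hk : 2 ≤ k)
    (g : CuspForm (Gamma1 M) k) (χ : DirichletCharacter ℂ M)
    (hg : g ∈ nebentypusSubspace M k χ) (hg0 : g ≠ 0) (a : ℕ → ℂ)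
    (haT : ∀ (p : ℕ) (hp : p.Prime), ¬ p ∣ M →
      (haveI : NeZero p := ⟨hp.ne_zero⟩; heckeT (Gamma1 M) k p g) = a p • g)
    (ℓ : ℕ) [Fact ℓ.Prime] (ι : PadicAlgCl ℓ ≃+* ℂ) :
    ∃ r : FramedGaloisRep ℚ (PadicAlgCl ℓ) 2,
      r.toGaloisRep.IsSemisimple ∧
      ∀ w : HeightOneSpectrum (𝓞 ℚ), ¬ ((primesEquiv w : Nat.Primes) : ℕ) ∣ M →
        ((primesEquiv w : Nat.Primes) : ℕ) ≠ ℓ →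
        r.IsUnramifiedAt w ∧
        r.HasFrobCharpolyAt w
          (X ^ 2 - C (ι.symm (a ((primesEquiv w : Nat.Primes) : ℕ))) * X +
            C (ι.symm (χ ((primesEquiv w : Nat.Primes) : ℕ) *
              (((primesEquiv w : Nat.Primes) : ℕ) : ℂ) ^ (k - 1)))) := by
  have hℓ : ℓ.Prime := Fact.out
  obtain ⟨π, hπ, hSat⟩ := hdict M k hk g χ hg hg0 a haT
  obtain ⟨r, hrss, hc⟩ := hA₂ hcpt π hπ ℓ ι
  refine ⟨r, hrss, fun w hw hwℓ ↦ ?_⟩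
  set p : ℕ := ((primesEquiv w : Nat.Primes) : ℕ) with hpdef
  have hp : p.Prime := (primesEquiv w).2
  have hℓw : ((ℓ : ℕ) : 𝓞 ℚ) ∉ w.asIdeal := natCast_not_mem_asIdeal_of_primesEquiv_ne hℓ hwℓ
  obtain ⟨hunr, hchar⟩ := Varma2024.corollary93_unramified_rat hc w hℓw _ (hSat w hw)
  refine ⟨hunr, ?_⟩
  have hq : w.residueCard = p := by
    rw [Rat.residueCard_eq_natGenerator]
    rfl
  have hmonic : ((X ^ 2 - C (a p) * X + C (χ p * (p : ℂ) ^ (k - 1)) : ℂ[X])).Monic := by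
    monicity!
  rw [hq, arithFrobPolyOfSatake_heckeRoots ι hp.pos hmonic] at hchar
  simpa only [Polynomial.map_add, Polynomial.map_sub, Polynomial.map_mul, Polynomial.map_pow,
    Polynomial.map_X, Polynomial.map_C, RingEquiv.toRingHom_eq_coe, RingHom.coe_coe] using hchar

/-- **Deligne–Serre 1974, Thm. 6.1 at every finite place, from the instance `n = 2`, `K = ℚ` of
Harris–Lan–Taylor–Thorne's Thm. A (existence) alone.**  The hypothesis `hA₂` is
`HarrisLanTaylorThorne2016.theoremA_existence` at `n = 2`, `K = ℚ` (totally real) and nothing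
more: for every regular algebraic cuspidal `π` on `GL₂(𝔸_ℚ)`, every prime `ℓ` and
`ι : ℚ̄_ℓ ≃+* ℂ`, a continuous semisimple `r : Γ_ℚ → GL₂(ℚ̄_ℓ)` compatible with `π`
(`IsCompatible`).  At the `π` attached to holomorphic eigenforms of weight `k ≥ 2` this instance
*is* Deligne's theorem (Rem. 6.2 of the paper) — the exact shape in which a construction of
Deligne's representations would discharge the named fact through the tree's automorphic road:
the compactness of `GL₂(𝒪̂_ℚ)` (`isCompact_glFiniteIntegralLevel_holds`), the dictionary
(`hdict_holds`) and the odd descent to `K_v` (`thm61_exists_adicGaloisRep_of_deligne_padicAlgCl`,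
footnote (2), p. 521) are theorems.
[cite: DeligneSerreASENS1974, Thm. 6.1 (p. 520), Rem. 6.2 and footnote (2) (p. 521)]
[cite: HarrisLanTaylorThorneRMS2016, Thm. A (p. 3)] -/
theorem thm61_exists_adicGaloisRep_of_theoremA_rankTwoRat
    (hA₂ : ∀ (hcpt : isCompact_glFiniteIntegralLevel 2 ℚ) (π : CuspidalAutomorphicRepData 2 ℚ hcpt),
      π.1.IsRegularAlgebraic → ∀ (ℓ : ℕ) [Fact ℓ.Prime] (ι : PadicAlgCl ℓ ≃+* ℂ),
        ∃ r : FramedGaloisRep ℚ (PadicAlgCl ℓ) 2,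
          r.toGaloisRep.IsSemisimple ∧ HarrisLanTaylorThorne2016.IsCompatible π.1 ι r) :
    thm61_exists_adicGaloisRep :=
  thm61_exists_adicGaloisRep_of_deligne_padicAlgCl
    (fun M _ k hk g χ hg hg0 a haT ℓ _ ι ↦
      deligne_padicAlgCl_of_theoremA_rankTwoRat_of_dictionary hA₂
        (isCompact_glFiniteIntegralLevel_holds 2 ℚ)
        (hdict_holds (isCompact_glFiniteIntegralLevel_holds 2 ℚ)) M k hk g χ hg hg0 a haT ℓ ι)

/-! ### The residue in the tree's named automorphic leaves -/

/-- **Deligne–Serre 1974, Thm. 6.1 at every finite place from the three automorphic leaves of the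
tree's proof of Harris–Lan–Taylor–Thorne's Thm. A** — Cor. 6.27 (`corollary627_splitOrUnramified`,
named fact), the archimedean clause of Arthur–Clozel's strong lifting
(`ArthurClozel1989_strongLifting_archimedean`, named fact) and Arthur–Clozel's strong cuspidal base
change in prime degree in its raw form `hBC` (Ch. 3, Thm. 4.2 (a) with Thm. 5.1 and (1.1): for
`E/F` Galois of prime degree ramified at a place where the cuspidal `π` is unramified, a cuspidal
`Π` on `GL_n(𝔸_E)` with `t_{Π,w} = t_{π,v}^{f(w|v)}` at every `w` over a `v` unramified in `E`):
`theoremA_existence_of_baseChange` (`ReciprocityGLnExistenceProofs`: the printed proof of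
Cor. 7.14, `n ≥ 2`) at `n = 2` over the totally real field `ℚ`, fed to
`thm61_exists_adicGaloisRep_of_theoremA_rankTwoRat`.  The rank-one case of Thm. A (Weil's theorem)
is not used.
[cite: DeligneSerreASENS1974, Thm. 6.1 (p. 520)]
[cite: HarrisLanTaylorThorneRMS2016, Thm. A (p. 3), Cor. 6.27 (p. 225), Cor. 7.14 (p. 232)]
[cite: ArthurClozelAMS120, Ch. 3, Thm. 4.2 (a) and Thm. 5.1] -/
theorem thm61_exists_adicGaloisRep_of_leaves
    (h627 : HarrisLanTaylorThorne2016.corollary627_splitOrUnramified)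
    (harch : ArthurClozel1989_strongLifting_archimedean)
    (hBC : ∀ (n : ℕ) (F E : Type) [Field F] [NumberField F] [Field E] [NumberField E] [Algebra F E]
      [IsGalois F E], (Module.finrank F E).Prime →
      ∀ (hF : isCompact_glFiniteIntegralLevel n F) (π : CuspidalAutomorphicRepData n F hF),
        (∃ v : HeightOneSpectrum (𝓞 F),
            ¬ Algebra.IsUnramifiedIn (𝓞 E) v.asIdeal ∧ π.1.IsUnramifiedAt v) →
        ∀ (hE : isCompact_glFiniteIntegralLevel n E),
          ∃ P : CuspidalAutomorphicRepData n E hE,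
            ∀ (w : HeightOneSpectrum (𝓞 E)) (v : HeightOneSpectrum (𝓞 F)) (α : Multiset ℂ),
              w.asIdeal.under (𝓞 F) = v.asIdeal → Algebra.IsUnramifiedIn (𝓞 E) v.asIdeal →
                π.1.HasSatakeParamAt v α →
                  P.1.HasSatakeParamAt w (α.map (· ^ w.asIdeal.inertiaDeg (𝓞 F)))) :
    thm61_exists_adicGaloisRep :=
  thm61_exists_adicGaloisRep_of_theoremA_rankTwoRat fun hcpt π hπ _ _ ι ↦
    HarrisLanTaylorThorne2016.theoremA_existence_of_baseChange h627 harch hBC hcpt one_lt_two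
      (Or.inl inferInstance) π hπ ι

/-- **Deligne–Serre 1974, Thm. 6.1 at every finite place from NAMED leaves only**: Harris–Lan–
Taylor–Thorne's Cor. 6.27, the archimedean clause and Arthur–Clozel's strong cuspidal base change
in prime degree as the named fact `ArthurClozel1989_strongLifting_cuspidal`
(`BaseChangeStrongCuspidalPrime`), through `theoremA_existence_of_namedLeaves` and
`thm61_exists_adicGaloisRep_of_theoremA`.  These three names are the exact residue of a discharge
`thm61_exists_adicGaloisRep_holds` along the tree's automorphic road (the other road being
Deligne's own construction, which the tree does not have).
[cite: DeligneSerreASENS1974, Thm. 6.1 (p. 520)]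
[cite: HarrisLanTaylorThorneRMS2016, Thm. A (p. 3), Cor. 6.27 (p. 225)]
[cite: ArthurClozelAMS120, Ch. 3, Thm. 4.2 (a) and Thm. 5.1] -/
theorem thm61_exists_adicGaloisRep_of_namedLeaves
    (h627 : HarrisLanTaylorThorne2016.corollary627_splitOrUnramified)
    (harch : ArthurClozel1989_strongLifting_archimedean)
    (hBC : ArthurClozel1989_strongLifting_cuspidal) : thm61_exists_adicGaloisRep :=
  thm61_exists_adicGaloisRep_of_theoremA
    (HarrisLanTaylorThorne2016.theoremA_existence_of_namedLeaves h627 harch hBC)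

end RankTwoRat

end Literature.NumberTheory.EllipticCurves.ModularForms.DeligneSerre1974

end
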